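import Literature.Combinatorics.SimpleGraph.HarmonicMorphismsPushforward
import Literature.Combinatorics.SimpleGraph.EdgeCutsEdgeConnectivity
import HarnessLib

/-!
# Hyperelliptic graphs: definition, genus two, edge connectivity at most two, transfer along
# harmonic morphisms, and uniqueness of the `g¹₂` (Baker–Norine 2009, §5.1)

Source (held, read at the page; statements VERBATIM). M. Baker, S. Norine, *Harmonic morphisms
and hyperelliptic graphs*, Int. Math. Res. Not. IMRN 2009, no. 15, 2914–2955 [BakerNorine2009]
(held text `paper:arxiv-0707.1309`, chunk p0016). §5.1: «We say that a graph `G` is hyperelliptic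
if there exists a divisor `D ∈ Div(G)` such that `deg(D) = 2` and `r(D) = 1`. By Riemann–Roch for
graphs, if `G` is hyperelliptic then `g(G) ≥ 2`, and by Clifford's theorem for graphs, if
`g(G) ≥ 2` and `deg(D) = 2`, then `r(D) = 1` if and only if `r(D) ≥ 1`.» **Example 40.** «Every
graph of genus `2` is hyperelliptic. Indeed, if `g(G) = 2`, then by Riemann–Roch for graphs, the
canonical divisor `K_G` has `deg(K_G) = 2` and `r(K_G) = 1`.» **Lemma 42.** «If `G` is a
hyperelliptic graph, then either `|V(G)| = 2` (so that `G` is isomorphic to a graph of the form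
`B(1,1,…,1)`) or `G` has edge connectivity at most 2.» (proof: «Let `D = (x) + (x′)` […] choose
a vertex `y ∈ V(G)` with `y ∉ {x, x′}`. Since `r(D) = 1`, there exists `y′ ∈ V(G)` such that
`(x) + (x′) ∼ (y) + (y′)`, and therefore the map `S^{(2)} : Div₊²(G) → Jac(G)` is not injective.
By Theorem 7, it follows that `G` is not 3-edge-connected.») **Corollary 43.** «If `G` is
hyperelliptic and `φ : G → G′` is a non-constant harmonic morphism onto a graph `G′` with
`g(G′) ≥ 2`, then `G′` is hyperelliptic as well.» **Proposition 44.** «If `D, D′` are degree 2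
divisors on `G` with `r(D) = r(D′) = 1`, then `D ∼ D′`.» (proof: «We may assume that
`g := g(G) ≥ 2`. Consider the divisor `E := D + (g−2)D′` of degree `2g−2` on `G`. By Lemma 2, we
have `r(E) ≥ g−1`. By Riemann–Roch for graphs, we have `r(K_G − E) ≥ 0`; since `deg(K_G − E) = 0`,
it follows that `K_G ∼ E`. Applying the same reasoning to `E′ := (g−1)D′`, we see that `K_G ∼ E′`,
and therefore `D ∼ D′` as desired.»)

## What is formalised (simple connected graphs; lineage vocabulary `rank` = `r`, `genus` = `g`,
## `LinEquiv` = `∼`, `Winnable D` = `|D| ≠ ∅`, `canonicalDivisor` = `K_G`)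

* `IsHyperelliptic G` — the printed definition;
* the Riemann–Roch remark in the form that holds for the printed definition:
  `IsHyperelliptic G → 1 ≤ g(G)` (`one_le_genus`). NOTE. With the printed definition a graph of
  genus `1` is hyperelliptic too (`isHyperelliptic_of_genus_eq_one`: by Riemann–Roch every
  degree-`2` divisor on it has `r = 2 − 1 = 1`), so the printed «`g(G) ≥ 2`» is recorded here as
  the explicit hypothesis `2 ≤ genus G` that every later statement of the source carries anyway
  («a 2-edge-connected graph of genus at least 2»; the abstract's «which is not a cycle»);
* the Clifford remark `deg(D) = 2, g ≥ 2 ⟹ (r(D) = 1 ↔ r(D) ≥ 1)` (`rank_eq_one_iff_of_sum_eq_two`);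
* **Example 40** (`isHyperelliptic_of_genus_eq_two`);
* **Lemma 42** for simple graphs, where `|V(G)| = 2` cannot occur: a hyperelliptic graph is not
  `3`-edge-connected (`IsHyperelliptic.not_isEdgeConnected_three`, through Theorem 7 =
  `abelJacobi_injective_iff_isEdgeConnected`);
* **Corollary 43** (`IsHyperelliptic.map`, through Corollary 28 = `rank_le_rank_divPushforward`);
* **Proposition 44** with the hypothesis `g ≥ 2` of its proof (`linEquiv_of_rank_eq_one`).

One definition with body and theorems; no `sorry`; no named facts.
-/

open Finset SimpleGraph Matrix
open Literature.Combinatorics.SimpleGraph.ChipFiring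

namespace Literature.Combinatorics.SimpleGraph.BakerNorine

variable {V : Type*} [Fintype V] [DecidableEq V] (G : SimpleGraph V) [DecidableRel G.Adj]

/-! ### §1 The definition and the Riemann–Roch / Clifford remarks -/

/-- **Hyperelliptic graph**: «there exists a divisor `D ∈ Div(G)` such that `deg(D) = 2` and
`r(D) = 1`». [cite: BakerNorine2009, §5.1] -/
def IsHyperelliptic : Prop := ∃ D : V → ℤ, ∑ v, D v = 2 ∧ rank G D = 1

/-- Unfolding `IsHyperelliptic`. [cite: BakerNorine2009, §5.1] -/
theorem isHyperelliptic_iff : IsHyperelliptic G ↔ ∃ D : V → ℤ, ∑ v, D v = 2 ∧ rank G D = 1 :=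
  Iff.rfl

variable {G}

/-- By Riemann–Roch a hyperelliptic graph has positive genus: on a tree every degree-`2` divisor
has `r = 2` («By Riemann–Roch for graphs, if `G` is hyperelliptic then» its genus is not `0`).
[cite: BakerNorine2009, §5.1] -/
theorem IsHyperelliptic.one_le_genus (hG : G.Connected) (h : IsHyperelliptic G) : 1 ≤ genus G := by
  obtain ⟨D, hD, hr⟩ := h
  by_contra hg
  have h0 : genus G = 0 := le_antisymm (by omega) (genus_nonneg G hG)
  have := rank_eq_of_lt_sum hG (D := D) (by rw [h0, hD]; norm_num)
  omega

/-- NOTE on the printed «`g(G) ≥ 2`»: with the printed definition a connected graph of genus `1`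
is hyperelliptic — every degree-`2` divisor has `r(D) = deg(D) − g = 1` by Riemann–Roch (the
later statements of the source assume `g ≥ 2` explicitly).
[cite: BakerNorine2009, §5.1 (definition) with Theorem 3 (Riemann–Roch)] -/
theorem isHyperelliptic_of_genus_eq_one (hG : G.Connected) (h : genus G = 1) :
    IsHyperelliptic G := by
  obtain ⟨v⟩ := hG.nonempty
  refine ⟨Pi.single v 2, by simp, ?_⟩
  rw [rank_eq_of_lt_sum hG (by rw [h]; simp), h]
  simp

/-- The Clifford remark: «if `g(G) ≥ 2` and `deg(D) = 2`, then `r(D) = 1` if and only if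
`r(D) ≥ 1`». [cite: BakerNorine2009, §5.1 (with Corollary 4, Clifford)] -/
theorem rank_eq_one_iff_of_sum_eq_two (hG : G.Connected) (hg : 2 ≤ genus G) {D : V → ℤ}
    (hD : ∑ v, D v = 2) : rank G D = 1 ↔ 1 ≤ rank G D := by
  haveI : Nonempty V := hG.nonempty
  refine ⟨fun h => h.symm.le, fun h => le_antisymm ?_ h⟩
  -- `|D| ≠ ∅` and, by Riemann–Roch, `|K − D| ≠ ∅`; Clifford gives `2 r(D) ≤ 2`
  have hw : Winnable G D := (rank_nonneg_iff G D).1 (by omega)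
  have hRR := rank_sub_rank_canonical_sub hG D
  have hwK : Winnable G (canonicalDivisor G - D) := (rank_nonneg_iff G _).1 (by omega)
  have := two_mul_rank_le_sum hG hw hwK
  omega

/-- A hyperelliptic graph of genus `≥ 2` in the «`r(D) ≥ 1`» form.
[cite: BakerNorine2009, §5.1] -/
theorem isHyperelliptic_iff_exists_one_le_rank (hG : G.Connected) (hg : 2 ≤ genus G) :
    IsHyperelliptic G ↔ ∃ D : V → ℤ, ∑ v, D v = 2 ∧ 1 ≤ rank G D := by
  refine exists_congr fun D => and_congr_right fun hD => ?_
  rw [rank_eq_one_iff_of_sum_eq_two hG hg hD]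

/-! ### §2 Example 40: genus two -/

/-- **Example 40**: «Every graph of genus `2` is hyperelliptic» — `deg(K_G) = 2` and
`r(K_G) = 1`. [cite: BakerNorine2009, Example 40] -/
theorem isHyperelliptic_of_genus_eq_two (hG : G.Connected) (h : genus G = 2) :
    IsHyperelliptic G :=
  ⟨canonicalDivisor G, by rw [sum_canonicalDivisor, h]; norm_num,
    by rw [rank_canonicalDivisor hG, h]; norm_num⟩

/-! ### §3 Lemma 42: hyperelliptic graphs are not 3-edge-connected -/

omit [DecidableEq V] in
/-- A simple connected graph on at most two vertices has genus `≤ 0` (so `|V(G)| = 2` does not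
occur for simple hyperelliptic graphs). [cite: BakerNorine2009, Lemma 42 («either `|V(G)| = 2`
…»)] -/
theorem genus_le_zero_of_card_le_two (hG : G.Connected) (h : Fintype.card V ≤ 2) : genus G ≤ 0 := by
  have hne : 0 < Fintype.card V := Fintype.card_pos_iff.2 hG.nonempty
  have hE := G.card_edgeFinset_le_card_choose_two
  rw [genus_eq]
  interval_cases hV : Fintype.card V
  · simp only [Nat.choose_succ_self, nonpos_iff_eq_zero, Finset.card_eq_zero] at hE
    rw [hE]
    simp
  · have : #G.edgeFinset ≤ 1 := by simpa using hE
    omega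

/-- A hyperelliptic simple graph has at least three vertices.
[cite: BakerNorine2009, Lemma 42 (proof: «If `|V(G)| > 2`, choose a vertex `y ∉ {x, x′}`»)] -/
theorem IsHyperelliptic.three_le_card (hG : G.Connected) (h : IsHyperelliptic G) :
    3 ≤ Fintype.card V := by
  by_contra hlt
  have := genus_le_zero_of_card_le_two hG (by omega)
  have := h.one_le_genus hG
  omega

/-- The heart of Lemma 42: a degree-`2` divisor with `r(D) = 1` on a graph with at least three
vertices is linearly equivalent to two distinct effective divisors («`(x) + (x′) ∼ (y) + (y′)`»),
so `S^{(2)}` is not injective. [cite: BakerNorine2009, Lemma 42 (proof)] -/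
theorem exists_ne_linEquiv_of_rank_eq_one (hG : G.Connected) (hV : 3 ≤ Fintype.card V)
    {D : V → ℤ} (hD : ∑ v, D v = 2) (hr : rank G D = 1) :
    ∃ E E' : V → ℤ, 0 ≤ E ∧ 0 ≤ E' ∧ ∑ v, E v = 2 ∧ ∑ v, E' v = 2 ∧ E ≠ E' ∧ LinEquiv G E E' := by
  haveI : Nonempty V := hG.nonempty
  -- `|D| ≠ ∅`: `D ∼ E` effective of degree `2`
  obtain ⟨E, hE, hDE⟩ : Winnable G D := (rank_nonneg_iff G D).1 (by omega)
  have hEs : ∑ v, E v = 2 := by rw [← hDE.sum_eq, hD]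
  -- a vertex `y` off the support of `E` (at most two vertices carry chips)
  obtain ⟨y, hy⟩ : ∃ y, E y = 0 := by
    by_contra hall
    push Not at hall
    have h1 : ∀ v, 1 ≤ E v := fun v => by
      have h0 : (0 : ℤ) ≤ E v := hE v
      have := hall v
      omega
    have : (3 : ℤ) ≤ ∑ v, E v := by
      calc (3 : ℤ) ≤ Fintype.card V := by exact_mod_cast hV
        _ = ∑ _v : V, (1 : ℤ) := by simp
        _ ≤ ∑ v, E v := Finset.sum_le_sum fun v _ => h1 v
    omega
  -- `r(D) ≥ 1`: `D − (y) ∼ (y′)`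
  have h1 : (((1 : ℕ) : ℤ)) ≤ rank G D := by rw [hr]; norm_num
  have hy1 : (0 : V → ℤ) ≤ Pi.single y 1 := fun v => by
    by_cases hv : v = y
    · subst hv; simp
    · simp [hv]
  obtain ⟨F, hF, hDF⟩ := (le_rank_iff G D 1).1 h1 (Pi.single y 1) hy1
    (by rw [Finset.sum_pi_single']; simp)
  have hFs : ∑ v, F v = 1 := by
    rw [← hDF.sum_eq]
    simp only [Pi.sub_apply, Finset.sum_sub_distrib, hD, Finset.sum_pi_single', mem_univ, if_true]
    norm_num
  obtain ⟨y', rfl⟩ := eq_single_of_nonneg_of_sum_eq_one hF hFs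
  refine ⟨E, Pi.single y 1 + Pi.single y' 1, hE, add_nonneg hy1 fun v => ?_, hEs, ?_, ?_, ?_⟩
  · by_cases hv : v = y'
    · subst hv; simp
    · simp [hv]
  · simp only [Pi.add_apply, Finset.sum_add_distrib, Finset.sum_pi_single', mem_univ, if_true]
    norm_num
  · intro hEq
    have := congrFun hEq y
    rw [hy, Pi.add_apply, Pi.single_eq_same] at this
    have h0 : (0 : ℤ) ≤ (Pi.single y' 1 : V → ℤ) y := by
      by_cases hv : y = y'
      · subst hv; simp
      · simp [hv]
    omega
  · -- `E ∼ D = (D − (y)) + (y) ∼ (y′) + (y)`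
    have h2 : LinEquiv G D (Pi.single y 1 + Pi.single y' 1) := by
      have := hDF.add_right (Pi.single y 1)
      rwa [sub_add_cancel, add_comm] at this
    exact hDE.symm.trans h2

/-- **Lemma 42** (simple graphs): a hyperelliptic graph is not `3`-edge-connected («`G` has edge
connectivity at most 2»; the alternative «`|V(G)| = 2`» of the source needs parallel edges).
[cite: BakerNorine2009, Lemma 42 (with Theorem 7)] -/
theorem IsHyperelliptic.not_isEdgeConnected_three (hG : G.Connected) (h : IsHyperelliptic G) :
    ¬ G.IsEdgeConnected 3 := by
  obtain ⟨v₀⟩ := hG.nonempty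
  obtain ⟨D, hD, hr⟩ := h
  obtain ⟨E, E', hE, hE', hEs, hE's, hne, hEE'⟩ :=
    exists_ne_linEquiv_of_rank_eq_one hG (IsHyperelliptic.three_le_card hG ⟨D, hD, hr⟩) hD hr
  rw [← abelJacobi_injective_iff_isEdgeConnected hG v₀ 2, abelJacobi_injective_iff]
  intro hinj
  exact hne (hinj E E' hE hE' (by rw [hEs]; rfl) (by rw [hE's]; rfl) hEE')

/-! ### §4 Corollary 43: hyperellipticity descends along harmonic morphisms -/

/-- **Corollary 43**: «If `G` is hyperelliptic and `φ : G → G′` is a non-constant harmonic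
morphism onto a graph `G′` with `g(G′) ≥ 2`, then `G′` is hyperelliptic as well» (through
Corollary 28, `r_{G′}(φ_*(D)) ≥ r_G(D)`, and the Clifford remark on `G′`).
[cite: BakerNorine2009, Corollary 43] -/
theorem IsHyperelliptic.map {V' : Type*} [Fintype V'] [DecidableEq V'] {G' : SimpleGraph V'}
    [DecidableRel G'.Adj] {φ : V → V'} (hφ : IsHarmonicMorphism G G' φ) (hG : G.Connected)
    (hG' : G'.Connected) (hφs : Function.Surjective φ) (hg' : 2 ≤ genus G')
    (h : IsHyperelliptic G) : IsHyperelliptic G' := by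
  obtain ⟨D, hD, hr⟩ := h
  refine (isHyperelliptic_iff_exists_one_le_rank hG' hg').2 ⟨divPushforward φ D, ?_, ?_⟩
  · rw [sum_divPushforward, hD]
  · rw [← hr]
    exact hφ.rank_le_rank_divPushforward hG hφs D

/-! ### §5 Proposition 44: uniqueness of the degree-two linear system -/

/-- Iterating Lemma 2: `r(nD′) ≥ n` when `r(D′) = 1`.
[cite: BakerNorine2009, Proposition 44 (proof, «By Lemma 2, we have `r(E) ≥ g−1`»)] -/
theorem le_rank_nsmul_of_rank_eq_one [Nonempty V] {D' : V → ℤ} (h : rank G D' = 1) (n : ℕ) :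
    (n : ℤ) ≤ rank G (n • D') := by
  induction n with
  | zero => rw [zero_smul, rank_zero]; rfl
  | succ n ih =>
    rw [succ_nsmul]
    have := rank_add_le_rank_add G (D := n • D') (D' := D') (by omega) (by omega)
    push_cast
    omega

/-- A divisor of degree `2g − 2` with `r ≥ g − 1` is linearly equivalent to `K_G` («By
Riemann–Roch for graphs, we have `r(K_G − E) ≥ 0`; since `deg(K_G − E) = 0`, it follows that
`K_G ∼ E`»). [cite: BakerNorine2009, Proposition 44 (proof)] -/
theorem linEquiv_canonicalDivisor_of_le_rank (hG : G.Connected) {E : V → ℤ}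
    (hE : ∑ v, E v = 2 * genus G - 2) (hr : genus G - 1 ≤ rank G E) :
    LinEquiv G (canonicalDivisor G) E := by
  haveI : Nonempty V := hG.nonempty
  have hRR := rank_sub_rank_canonical_sub hG E
  have h0 : ∑ v, (canonicalDivisor G - E) v = 0 := by
    simp only [Pi.sub_apply, Finset.sum_sub_distrib, sum_canonicalDivisor, hE, sub_self]
  have hw : Winnable G (canonicalDivisor G - E) := (rank_nonneg_iff G _).1 (by omega)
  have h1 := (winnable_iff_linEquiv_zero_of_sum_eq_zero G h0).1 hw
  have := h1.add_right E
  rwa [sub_add_cancel, zero_add] at this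

/-- **Proposition 44**: «If `D, D′` are degree 2 divisors on `G` with `r(D) = r(D′) = 1`, then
`D ∼ D′`» (for `g ≥ 2`, the case treated by the printed proof; false in genus `1`).
[cite: BakerNorine2009, Proposition 44] -/
theorem linEquiv_of_rank_eq_one (hG : G.Connected) (hg : 2 ≤ genus G) {D D' : V → ℤ}
    (hD : ∑ v, D v = 2) (hD' : ∑ v, D' v = 2) (hr : rank G D = 1) (hr' : rank G D' = 1) :
    LinEquiv G D D' := by
  haveI : Nonempty V := hG.nonempty
  obtain ⟨n, hn⟩ : ∃ n : ℕ, (n : ℤ) = genus G - 2 := ⟨(genus G - 2).toNat, Int.toNat_of_nonneg (by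
    omega)⟩
  have hsum_nsmul : ∀ m : ℕ, ∑ v, (m • D') v = 2 * m := fun m => by
    have hv : ∀ v, (m • D') v = (m : ℤ) * D' v := fun v => by simp
    simp_rw [hv, ← Finset.mul_sum, hD']
    ring
  -- `E := D + (g−2)D′ ∼ K`
  have hE : LinEquiv G (canonicalDivisor G) (D + n • D') := by
    refine linEquiv_canonicalDivisor_of_le_rank hG ?_ ?_
    · simp only [Pi.add_apply, Finset.sum_add_distrib, hD]
      rw [show ∑ v, (n • D') v = 2 * n from hsum_nsmul n]
      omega
    · have h1 := le_rank_nsmul_of_rank_eq_one hr' n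
      have h2 := rank_add_le_rank_add G (D := D) (D' := n • D') (by omega) (by omega)
      omega
  -- `E′ := (g−1)D′ ∼ K`
  have hE' : LinEquiv G (canonicalDivisor G) ((n + 1) • D') := by
    refine linEquiv_canonicalDivisor_of_le_rank hG ?_ ?_
    · rw [hsum_nsmul (n + 1)]
      push_cast
      omega
    · have h1 := le_rank_nsmul_of_rank_eq_one hr' (n + 1)
      push_cast at h1
      omega
  have h := hE.symm.trans hE'
  rw [succ_nsmul] at h
  -- cancel `(g−2)D′`
  have := h.sub_right (n • D')
  rwa [add_sub_cancel_right, add_sub_cancel_left] at this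

/-- **Proposition 44** for hyperelliptic data: on a graph of genus `≥ 2` all degree-`2` divisors
with `r ≥ 1` are linearly equivalent («there is at most one complete linear system `|D|` of
degree 2 on a graph `G` for which `r(D) = 1`»). [cite: BakerNorine2009, Proposition 44] -/
theorem linEquiv_of_one_le_rank (hG : G.Connected) (hg : 2 ≤ genus G) {D D' : V → ℤ}
    (hD : ∑ v, D v = 2) (hD' : ∑ v, D' v = 2) (hr : 1 ≤ rank G D) (hr' : 1 ≤ rank G D') :
    LinEquiv G D D' :=
  linEquiv_of_rank_eq_one hG hg hD hD' ((rank_eq_one_iff_of_sum_eq_two hG hg hD).2 hr)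
    ((rank_eq_one_iff_of_sum_eq_two hG hg hD').2 hr')

end Literature.Combinatorics.SimpleGraph.BakerNorine
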